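import Summits.HubbardSuperconductivity.HubbardSuperconductivity.Theorems.JosephsonMirrorJmCuspGainAbstract
import Summits.HubbardSuperconductivity.HubbardSuperconductivity.Theorems.JosephsonMirrorJmCuspDedoubleTools
import Summits.HubbardSuperconductivity.HubbardSuperconductivity.Theorems.JosephsonMirrorJmCuspSectorGap
import Summits.HubbardSuperconductivity.HubbardSuperconductivity.Theorems.AposterioriCapRgSsbToEvenTorusLroPairTransferRung
import Summits.HubbardSuperconductivity.HubbardSuperconductivity.Theorems.JosephsonMirrorJmInterchangeZepoGivesHypAux

/-!
# Route `JosephsonMirror` — zero-excess pair order ⇒ Josephson gain (`ZEPOGivesHyp`)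

Helper file (2 of 2) for the crux stmt-HubbardSuperconductivity-2227 (`JmInterchange`) of route
`JosephsonMirror` (sub-problem `HubbardSuperconductivity`), line `Sketch`, stub `stub_zepoGivesHyp`:
the CONVERSE half of the normal form. ZERO-EXCESS PAIR ORDER at `(U, δ)` — for every `ε > 0`,
eventually in even `L`, a unit vector `v` of sector `n ∈ {N_L, N_L - 2}` (`S^z = 0`) with
`Re⟨v, Hv⟩ ≤ e(n) + εL²` and `‖Δ_d v‖² ≥ cL⁴` — gives uniform linear Josephson gain
`(c/4) J L² ≤ E_L(0) - E_L(J)` of the window double for `J ∈ (0, 1]` and large even `L`.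

Proof: the tree's trial-pair bound `trialPair_gain_le_minEnergyOn_sub`
(`Theorems/JosephsonMirrorJmCuspGainAbstract`) for the pair `(v, Δv/‖Δv‖)` (or `(Δᴴv/‖Δᴴv‖, v)`
when `v` sits in `N_L - 2`): the coupling is `‖Δv‖²/L² ≥ (c/2)L²`, the excess of `v` is `≤ εL²`,
and the excess of the partner is `≤ (cJ/8)L² + O(1)` for `ε = ε(J)` small
(`partner_excess_le` of `Theorems/JosephsonMirrorJmInterchangeZepoGivesHypAux`, with
`‖H‖, ‖[H, Δ]‖, ‖Δ‖ = O(L²)`, the two-particle cost `|e(N_L) - e(N_L - 2)| = O(1)`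
(`ptr_twoParticleCost`) and the pair-commutator budget `|‖Δᴴv‖² - ‖Δv‖²| = O(L²)`
(`ptr_pairCommutator_budget`)).

Sources: T. Koma, H. Tasaki, J. Stat. Phys. 76 (1994) 745 (LRO ⇒ SSB, trial states);
E. H. Lieb, Phys. Rev. Lett. 62 (1989) 1201 (the `W`-matrix packaging); H. Tasaki, *Physics and
Mathematics of Quantum Many-Body Systems* (2020) §2.2. All statements are folklore
finite-dimensional linear algebra. No new definitions.
-/

-- the mandated namespace `Summit.<Summit>.<Problem>.Theorems` repeats `HubbardSuperconductivity`
-- (single-problem summit, D-0017), which the `dupNamespace` linter flags on every declaration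
set_option linter.dupNamespace false

namespace Summit.HubbardSuperconductivity.HubbardSuperconductivity.Theorems.JosephsonMirror

open Matrix Literature.MathematicalPhysics.QuantumLattice Literature.Probability.LatticeModels
open Literature.MathematicalPhysics.QuantumLattice.ThermodynamicLimit (star_mulVec_dotProduct)
open scoped Kronecker ComplexOrder Matrix.Norms.L2Operator

section Torus

/-- **`ZEPOGivesHyp`** (stub `stub_zepoGivesHyp` of line `Sketch`, crux `JmInterchange`): zero-excess
pair order at `(U, δ)` gives uniform linear Josephson gain of the window double, with `a = c/4`,
`J₀ = 1`. For `J ∈ (0, 1]` feed `ε = ε(J)` into the pair order; for large even `L` the unit vector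
`v` (sector `N_L` or `N_L - 2`, excess `≤ εL²`, `‖Δv‖² ≥ cL⁴`) and its normalised partner `Δv`
(resp. `Δᴴv`, `‖Δᴴv‖² ≥ ‖Δv‖² - O(L²)` by `ptr_pairCommutator_budget`) form a trial pair for
`trialPair_gain_le_minEnergyOn_sub` with coupling `≥ (c/2)JL²`, excess of `v` `≤ εL²` and excess
of the partner `≤ (cJ/8)L² + O(1)` (`partner_excess_le` with `‖H‖, ‖[H, Δ]‖, ‖Δ‖ = O(L²)` and
the two-particle cost `ptr_twoParticleCost`). Koma–Tasaki, J. Stat. Phys. 76 (1994) 745;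
Lieb, PRL 62 (1989) 1201. [folklore] -/
theorem zepoGivesHyp :
    ∀ (U δ : ℝ), 0 < U → δ ∈ Set.Ioo (0:ℝ) (1 / 2) →
    (∃ c : ℝ, 0 < c ∧ ∀ ε : ℝ, 0 < ε → ∃ L₀ : ℕ, ∀ (L : ℕ) [NeZero L], Even L → L₀ ≤ L →
      ∃ n : ℕ, (n = 2 * ⌊(1 - δ) * (L : ℝ) ^ 2 / 2⌋₊ ∨ n = 2 * ⌊(1 - δ) * (L : ℝ) ^ 2 / 2⌋₊ - 2) ∧
        ∃ v : Fock (Orb (FermionTorus 2 L)), v ∈ szSector n 0 ∧ star v ⬝ᵥ v = 1 ∧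
          (star v ⬝ᵥ (hubbardTorus 2 L 1 U *ᵥ v)).re ≤
              (hubbardTorus 2 L 1 U).minEnergyOn (szSector n 0) + ε * (L : ℝ) ^ 2 ∧
          c * (L : ℝ) ^ 4 ≤
            (star (pairField dWaveFormFactor L *ᵥ v) ⬝ᵥ (pairField dWaveFormFactor L *ᵥ v)).re) →
    ∃ a J₀ : ℝ, 0 < a ∧ 0 < J₀ ∧
      ∀ J ∈ Set.Ioc (0:ℝ) J₀, ∃ L₀ : ℕ, ∀ (L : ℕ) [NeZero L], Even L → L₀ ≤ L → (let ι : Type := Finset (Literature.MathematicalPhysics.QuantumLattice.Orb (Literature.MathematicalPhysics.QuantumLattice.FermionTorus 2 L)); let N : ℕ := 2 * ⌊(1 - δ) * (L : ℝ) ^ 2 / 2⌋₊; let H : Matrix ι ι ℂ := Literature.MathematicalPhysics.QuantumLattice.hubbardTorus 2 L 1 U; let μ : ℝ := (H.minEnergyOn (Literature.MathematicalPhysics.QuantumLattice.szSector N 0) - H.minEnergyOn (Literature.MathematicalPhysics.QuantumLattice.szSector (N - 2) 0)) / 2; let A : Matrix ι ι ℂ := Literature.MathematicalPhysics.QuantumLattice.hubbardTorusWith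 2 L 1 U μ; let D : Matrix ι ι ℂ := ((L : ℂ))⁻¹ • Literature.MathematicalPhysics.QuantumLattice.pairField Literature.MathematicalPhysics.QuantumLattice.dWaveFormFactor L; let Hd : ℝ → Matrix (ι × ι) (ι × ι) ℂ := fun J => Matrix.kroneckerMap (fun a b : ℂ => a * b) A 1 + Matrix.kroneckerMap (fun a b : ℂ => a * b) 1 (Matrix.transpose A) - (J : ℂ) • (Matrix.kroneckerMap (fun a b : ℂ => a * b) D (Matrix.transpose (Matrix.conjTranspose D)) + Matrix.kroneckerMap (fun a b : ℂ => a * b) (Matrix.conjTranspose D) (Matrix.transpose D)); let good : ι × ι → Prop := fun p => ((p.1.card = N ∧ p.2.card = N) ∨ (p.1.card = N - 2 ∧ p.2.card = N - 2)) ∧ (p.1.filter (fun o => (ofLex o).2 = 0)).card = (p.1.filter (fun o => (ofLex o).2 = 1)).card ∧ (p.2.filter (fun o => (ofLex o).2 = 0)).card = (p.2.filter (fun o => (ofLex o).2 = 1)).card; let S : Submodule ℂ (ι × ι → ℂ) := ⨅ (p : ι × ι) (_ : ¬ good p), LinearMap.ker (LinearMap.proj (R := ℂ) (φ := fun _ :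 ι × ι => ℂ) p); let E : ℝ → ℝ := fun J => (Hd J).minEnergyOn S; a * J * (L : ℝ) ^ 2 ≤ E 0 - E J) := by
  intro U δ hU hδ hZ
  obtain ⟨c, hc, hZ⟩ := hZ
  -- the `L`-independent constants
  obtain ⟨CP, hCP0, hCP⟩ := ptr_pairCommutator_budget
  obtain ⟨C₃, hC₃0, hC₃⟩ := ptr_twoParticleCost U (1 / 8) (by norm_num)
  set K : ℝ := (∑ e ∈ insert (0 : Site 2) unitSteps, ‖((dWaveFormFactor e / Real.sqrt 2 : ℝ) : ℂ)‖) *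
    (72 * (2 + |U|)) with hK
  have hK0 : 0 ≤ K := mul_nonneg (Finset.sum_nonneg fun _ _ => norm_nonneg _) (by positivity)
  set Φ : ℝ := (2 * (10 * (1 + U)) + 1) * 6 ^ 4 with hΦ
  have hΦ0 : 0 < Φ := by positivity
  set c' : ℝ := c / 2 with hc'
  have hc'0 : 0 < c' := by positivity
  refine ⟨c' / 2, 1, by positivity, one_pos, fun J hJ => ?_⟩
  obtain ⟨hJ0, -⟩ := hJ
  -- the AM–GM weight `σ` and the accuracy `ε = ε(J)` fed into the pair order
  set σ : ℝ := 4 * Φ / (c' ^ 2 * J) with hσ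
  have hσ0 : 0 < σ := by positivity
  have hσ1 : Φ / (2 * σ * c') = c' * J / 8 := by
    rw [hσ]
    field_simp
    ring
  set ε : ℝ := min 1 (min (c' * J / 8) (c' ^ 2 * J / (4 * σ))) with hεdef
  have hε0 : 0 < ε := lt_min one_pos (lt_min (by positivity) (by positivity))
  have hε1 : ε ≤ 1 := min_le_left _ _
  have hεa : ε ≤ c' * J / 8 := (min_le_right _ _).trans (min_le_left _ _)
  have hεb : σ * ε / (2 * c') ≤ c' * J / 8 := by
    have h : ε ≤ c' ^ 2 * J / (4 * σ) := (min_le_right _ _).trans (min_le_right _ _)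
    rw [le_div_iff₀ (by positivity)] at h
    rw [div_le_iff₀ (by positivity)]
    linarith
  obtain ⟨L₀, hL₀⟩ := hZ ε hε0
  set T : ℝ := 4 + 2 * CP / c + 8 * (6 * K / c' + C₃) / (c' * J) with hT
  refine ⟨max L₀ ⌈T⌉₊, fun L _ hE hL => ?_⟩
  intro ι N H μ A D Hd good S E
  obtain ⟨hLL₀, hLT⟩ := max_le_iff.1 hL
  obtain ⟨nn, hnn, v, hvmem, hv1, hvexc, hvpair⟩ := hL₀ L hE hLL₀
  have hTL : T ≤ (L : ℝ) := Nat.ceil_le.1 hLT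
  have hT₁ : 0 ≤ 2 * CP / c := by positivity
  have hT₂ : 0 ≤ 8 * (6 * K / c' + C₃) / (c' * J) := by positivity
  have hL4 : 4 ≤ L := by exact_mod_cast (show (4 : ℝ) ≤ L by linarith)
  -- the filling `N = 2n`, `1 ≤ n ≤ L²/2`, `L² ≤ 8n`
  obtain ⟨hn1, hnL, hn8⟩ := filling_floor_bounds hδ hL4
  have hδ0 : 0 ≤ 1 - δ := by linarith [hδ.2]
  have hnhalf : (⌊(1 - δ) * (L : ℝ) ^ 2 / 2⌋₊ : ℝ) ≤ (L : ℝ) ^ 2 / 2 :=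
    (Nat.floor_le (by positivity)).trans (div_le_div_of_nonneg_right
      (mul_le_of_le_one_left (by positivity) (by linarith [hδ.1])) two_pos.le)
  set n : ℕ := ⌊(1 - δ) * (L : ℝ) ^ 2 / 2⌋₊ with hn
  set X : ℝ := (L : ℝ) ^ 2 with hX
  have hX0 : 0 < X := by positivity
  have hLX : (L : ℝ) ≤ X := by
    rw [hX, sq]
    exact le_mul_of_one_le_left L.cast_nonneg (by exact_mod_cast Nat.one_le_iff_ne_zero.2 (NeZero.ne L))
  have hL4X : (L : ℝ) ^ 4 = X ^ 2 := by rw [hX]; ring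
  have hNn : N = 2 * n := rfl
  have hN2 : N - 2 = 2 * (n - 1) := by omega
  have hN2' : ((N - 2 : ℕ) : ℝ) = (N : ℝ) - 2 := by
    rw [Nat.cast_sub (by omega)]
    norm_num
  -- energies, chemical potential, common floor
  set e₁ : ℝ := H.minEnergyOn (szSector N 0) with he₁
  set e₂ : ℝ := H.minEnergyOn (szSector (N - 2) 0) with he₂
  have hμ : μ = (e₁ - e₂) / 2 := rfl
  set e₀ : ℝ := e₁ - μ * N with he₀
  have he₀₂ : e₀ = e₂ - μ * ((N - 2 : ℕ) : ℝ) := by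
    rw [hN2', he₀, hμ]
    ring
  have hAherm : A.IsHermitian := isHermitian_hamiltonianWith _ 1 U μ
  have hHherm : H.IsHermitian := LiebThm1.hamiltonian_isHermitian (fermionTorusGraph 2 L) 1 U
  -- blocks and the window
  set F : ι → Prop := fun s =>
    (s.filter fun o => (ofLex o).2 = 0).card = (s.filter fun o => (ofLex o).2 = 1).card with hF
  set P₁ : ι → Prop := fun s => s.card = N ∧ F s with hP₁
  set P₂ : ι → Prop := fun s => s.card = N - 2 ∧ F s with hP₂
  have h12 : ∀ s, P₁ s → ¬ P₂ s := by
    rintro s ⟨h1, -⟩ ⟨h2, -⟩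
    omega
  have hgood : ∀ s t, good (s, t) → (P₁ s ∧ P₁ t) ∨ (P₂ s ∧ P₂ t) := by
    rintro s t ⟨h | h, hs, ht⟩
    · exact Or.inl ⟨⟨h.1, hs⟩, ⟨h.2, ht⟩⟩
    · exact Or.inr ⟨⟨h.1, hs⟩, ⟨h.2, ht⟩⟩
  have hgood₁ : ∀ s t, P₁ s → P₁ t → good (s, t) := fun s t hs ht =>
    ⟨Or.inl ⟨hs.1, ht.1⟩, hs.2, ht.2⟩
  have hgood₂ : ∀ s t, P₂ s → P₂ t → good (s, t) := fun s t hs ht =>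
    ⟨Or.inr ⟨hs.1, ht.1⟩, hs.2, ht.2⟩
  have hS : ∀ ψ, ψ ∈ S ↔ ∀ p, ¬ good p → ψ p = 0 := by
    intro ψ
    simp only [S, Submodule.mem_iInf, LinearMap.mem_ker, LinearMap.proj_apply]
  have hA₁ : ∀ v : ι → ℂ, (∀ s, ¬ P₁ s → v s = 0) →
      e₀ * (star v ⬝ᵥ v).re ≤ (star v ⬝ᵥ A *ᵥ v).re := by
    intro v hv
    have h := block_rayleigh_lower L U μ hnL v (by simpa [hP₁, hF, hNn] using hv)
    rw [he₀, hNn]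
    exact h
  have hA₂ : ∀ v : ι → ℂ, (∀ s, ¬ P₂ s → v s = 0) →
      e₀ * (star v ⬝ᵥ v).re ≤ (star v ⬝ᵥ A *ᵥ v).re := by
    intro v hv
    have h := block_rayleigh_lower L U μ ((Nat.sub_le n 1).trans hnL) v
      (by simpa [hP₂, hF, hN2] using hv)
    rw [← hN2] at h
    rw [he₀₂]
    exact h
  -- sector membership: block support and the variational floors
  have toP₁ : ∀ z : ι → ℂ, z ∈ szSector N 0 → ∀ s, ¬ P₁ s → z s = 0 := fun z hz s hs =>
    (mem_szSector_two_mul_zero_iff n z).1 hz s fun h =>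
      hs (by simpa [hP₁, hF, hNn] using (block_iff n s).2 h)
  have toP₂ : ∀ z : ι → ℂ, z ∈ szSector (N - 2) 0 → ∀ s, ¬ P₂ s → z s = 0 := fun z hz s hs =>
    (mem_szSector_two_mul_zero_iff (n - 1) z).1 (hN2 ▸ hz) s fun h =>
      hs (by simpa [hP₂, hF, hN2] using (block_iff (n - 1) s).2 h)
  have hcard : n ≤ Fintype.card (FermionTorus 2 L) := by rwa [card_fermionTorus]
  have hK₁ : ∀ z ∈ szSector N 0, e₁ * (star z ⬝ᵥ z).re ≤ (star z ⬝ᵥ H *ᵥ z).re := fun z hz =>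
    (szSector_groundState (fermionTorusGraph 2 L) 1 U hcard).2 z
      ((mem_szSector_two_mul_zero_iff n z).1 hz)
  have hK₂ : ∀ z ∈ szSector (N - 2) 0, e₂ * (star z ⬝ᵥ z).re ≤ (star z ⬝ᵥ H *ᵥ z).re := by
    intro z hz
    have h := (szSector_groundState (fermionTorusGraph 2 L) 1 U ((Nat.sub_le n 1).trans hcard)).2 z
      ((mem_szSector_two_mul_zero_iff (n - 1) z).1 (hN2 ▸ hz))
    rw [← hN2] at h
    exact h
  -- norms: `‖H‖ ≤ 10(1+U)L²`, `‖Δ‖ ≤ 6L²`, `‖[H, Δ]‖, ‖[H, Δᴴ]‖ ≤ KL²`; two-particle cost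
  set P : Matrix ι ι ℂ := pairField dWaveFormFactor L with hPdef
  have hHn : ‖H‖ ≤ 10 * (1 + U) * X := by
    have h := CwSsbToEvenTorusLRO.Negative.norm_hubbardTorusWith_le_ten L U 0 hU.le
    rwa [hubbardTorusWith_zero, abs_zero, add_zero] at h
  have hPn : ‖P‖ ≤ 6 * X := CwSsbToEvenTorusLRO.Negative.norm_pairField_dWaveFormFactor_le_six L
  have hKP : ‖H * P - P * H‖ ≤ K * X :=
    Summit.HubbardSuperconductivity.EnslavedA1g.norm_commutator_hubbardTorus_pairField_le _ U L
  have hKPh : ‖H * Pᴴ - Pᴴ * H‖ ≤ K * X :=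
    norm_commutator_hubbardTorus_pairField_conjTranspose_le L U
  have hcost : |e₂ - e₁| ≤ C₃ := by
    have hL16 : (16 : ℝ) ≤ X := by
      have h := pow_le_pow_left₀ (by norm_num) (show (4 : ℝ) ≤ L by exact_mod_cast hL4) 2
      norm_num at h
      rwa [hX]
    have h := hC₃ L (n - 1) (by push_cast [Nat.cast_sub hn1]; linarith)
      (by push_cast [Nat.cast_sub hn1]; linarith)
    rw [← hN2, show N - 2 + 2 = N by omega] at h
    exact h
  -- the common shape of the partner bound
  have hbd : ∀ (Q : Matrix ι ι ℂ) (d Sq : ℝ), ‖Q‖ ≤ 6 * X → ‖H * Q - Q * H‖ ≤ K * X → d ≤ C₃ →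
      0 ≤ Sq → (2 * ‖H‖ + ε * X) * ‖Q‖ ^ 4 / (2 * (σ * X ^ 2)) + σ * X ^ 2 / 2 * (ε * X) +
        ‖Q‖ * ‖H * Q - Q * H‖ + d * Sq ≤
      Φ * X ^ 5 / (2 * (σ * X ^ 2)) + σ * X ^ 2 / 2 * (ε * X) + 6 * K * X ^ 2 + C₃ * Sq := by
    intro Q d Sq hQ hC hd hSq
    have h1 : (2 * ‖H‖ + ε * X) * ‖Q‖ ^ 4 ≤ Φ * X ^ 5 := by
      have hεX : ε * X ≤ 1 * X := mul_le_mul_of_nonneg_right hε1 hX0.le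
      have ha : 2 * ‖H‖ + ε * X ≤ (2 * (10 * (1 + U)) + 1) * X := by linarith
      calc (2 * ‖H‖ + ε * X) * ‖Q‖ ^ 4 ≤ (2 * (10 * (1 + U)) + 1) * X * (6 * X) ^ 4 :=
            mul_le_mul ha (pow_le_pow_left₀ (norm_nonneg _) hQ 4) (by positivity) (by positivity)
        _ = Φ * X ^ 5 := by rw [hΦ]; ring
    have h2 : ‖Q‖ * ‖H * Q - Q * H‖ ≤ 6 * X * (K * X) :=
      mul_le_mul hQ hC (norm_nonneg _) (by positivity)
    have h3 : d * Sq ≤ C₃ * Sq := mul_le_mul_of_nonneg_right hd hSq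
    have h4 := div_le_div_of_nonneg_right h1 (by positivity : (0 : ℝ) ≤ 2 * (σ * X ^ 2))
    have h5 : 6 * X * (K * X) = 6 * K * X ^ 2 := by ring
    linarith
  have hTX : 8 * (6 * K / c' + C₃) / (c' * J) ≤ X := by linarith
  rw [hL4X] at hvpair
  rcases hnn with rfl | rfl
  · -- `v` in sector `N`: partner `Δv` in sector `N - 2`
    have hPv : P *ᵥ v ∈ szSector (N - 2) 0 := by
      have h := WcbcsSsbToTorusLRO.pairFieldAt_mulVec_mem_szSector dWaveFormFactor
        (0 : TorusSite 2 L) (N := N) (by omega) hvmem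
      rwa [pairFieldAt_zero] at h
    have hx : Pᴴ *ᵥ (P *ᵥ v) ∈ szSector N 0 := by
      have h := WcbcsSsbToTorusLRO.conjTranspose_pairFieldAt_mulVec_mem_szSector dWaveFormFactor
        (0 : TorusSite 2 L) hPv
      rwa [pairFieldAt_zero, show N - 2 + 2 = N by omega] at h
    set Sx : ℝ := (star (P *ᵥ v) ⬝ᵥ (P *ᵥ v)).re with hSx
    have hSlow : c' * X ^ 2 ≤ Sx :=
      (mul_le_mul_of_nonneg_right (by rw [hc']; linarith) (sq_nonneg X)).trans hvpair
    have hSpos : 0 < Sx := lt_of_lt_of_le (by positivity) hSlow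
    obtain ⟨r, hr1, hrS⟩ := exists_smul_unit_of_pos hSpos
    have hvexc' : (star v ⬝ᵥ H *ᵥ v).re ≤ e₁ + ε * X := hvexc
    -- the two excesses
    have hev : (star v ⬝ᵥ A *ᵥ v).re - e₀ ≤ ε * X := by
      have h := re_rayleigh_hubbardTorusWith L U μ ((mem_szSector_iff N 0 v).1 hvmem).1
      rw [hv1, Complex.one_re, mul_one] at h
      have h' : (star v ⬝ᵥ A *ᵥ v).re = (star v ⬝ᵥ H *ᵥ v).re - μ * N := h
      rw [h', he₀]
      linarith
    have hew : ((star (r • P *ᵥ v) ⬝ᵥ A *ᵥ (r • P *ᵥ v)).re - e₀) * Sx ≤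
        Φ * X ^ 5 / (2 * (σ * X ^ 2)) + σ * X ^ 2 / 2 * (ε * X) + 6 * K * X ^ 2 + C₃ * Sx := by
      have hray : (star (P *ᵥ v) ⬝ᵥ A *ᵥ (P *ᵥ v)).re =
          (star (P *ᵥ v) ⬝ᵥ H *ᵥ (P *ᵥ v)).re - μ * ((N - 2 : ℕ) : ℝ) * Sx :=
        re_rayleigh_hubbardTorusWith L U μ ((mem_szSector_iff _ 0 _).1 hPv).1
      have hpart := partner_excess_le (e₂ := e₂) hHherm (szSector N 0) hK₁ hvmem hx hv1 hvexc'
        (by positivity : 0 < σ * X ^ 2)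
      have hid : ((star (r • P *ᵥ v) ⬝ᵥ A *ᵥ (r • P *ᵥ v)).re - e₀) * Sx =
          (star (P *ᵥ v) ⬝ᵥ H *ᵥ (P *ᵥ v)).re - e₂ * Sx := by
        rw [mulVec_smul, re_star_smul_dotProduct_smul, hray, he₀₂]
        linear_combination ((star (P *ᵥ v) ⬝ᵥ H *ᵥ (P *ᵥ v)).re - μ * ((N - 2 : ℕ) : ℝ) * Sx) * hrS
      rw [hid]
      exact hpart.trans (hbd P (e₁ - e₂) Sx hPn hKP (by linarith [(abs_le.1 hcost).1]) hSpos.le)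
    -- the coupling `|⟨w, D v⟩|² = ‖Δv‖²/L²`
    have hcoup : ‖star (r • P *ᵥ v) ⬝ᵥ D *ᵥ v‖ ^ 2 = Sx / X := by
      have hz : star (P *ᵥ v) ⬝ᵥ (P *ᵥ v) = ((Sx : ℝ) : ℂ) := by
        rw [hSx, ← eucNorm_sq]
        exact star_dotProduct_self_eq_eucNorm_sq _
      have hD : D = ((L : ℂ))⁻¹ • P := rfl
      rw [hD, smul_mulVec, star_smul, smul_dotProduct, dotProduct_smul, smul_smul, smul_eq_mul, hz,
        norm_mul, norm_mul, norm_star, norm_inv, Complex.norm_natCast, Complex.norm_real,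
        Real.norm_eq_abs, abs_of_pos hSpos, hX]
      calc (‖r‖ * (L : ℝ)⁻¹ * Sx) ^ 2 = ‖r‖ ^ 2 * Sx * Sx / (L : ℝ) ^ 2 := by ring
        _ = Sx / (L : ℝ) ^ 2 := by rw [hrS, one_mul]
    have key := trialPair_gain_le_minEnergyOn_sub A D hAherm P₁ P₂ h12 good hgood hgood₁ hgood₂ S
      hS e₀ hA₁ hA₂ v (r • P *ᵥ v) (toP₁ v hvmem) (toP₂ _ (Submodule.smul_mem _ r hPv)) hv1 hr1
      hJ0.le
    rw [hcoup] at key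
    exact gain_endgame hJ0 hX0 hc'0 (by positivity) hσ0 key hSlow hev hew hεa hσ1.le hεb hTX
  · -- `v` in sector `N - 2`: partner `Δᴴv` in sector `N`
    have hvmem' : v ∈ szSector (N - 2) 0 := hvmem
    have hPv : Pᴴ *ᵥ v ∈ szSector N 0 := by
      have h := WcbcsSsbToTorusLRO.conjTranspose_pairFieldAt_mulVec_mem_szSector dWaveFormFactor
        (0 : TorusSite 2 L) hvmem'
      rwa [pairFieldAt_zero, show N - 2 + 2 = N by omega] at h
    have hx : Pᴴᴴ *ᵥ (Pᴴ *ᵥ v) ∈ szSector (N - 2) 0 := by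
      have h := WcbcsSsbToTorusLRO.pairFieldAt_mulVec_mem_szSector dWaveFormFactor
        (0 : TorusSite 2 L) (N := N) (by omega) hPv
      rwa [pairFieldAt_zero, ← conjTranspose_conjTranspose (pairField dWaveFormFactor L)] at h
    set Sx : ℝ := (star (Pᴴ *ᵥ v) ⬝ᵥ (Pᴴ *ᵥ v)).re with hSx
    -- `‖Δᴴv‖² ≥ ‖Δv‖² - C_P L² ≥ (c/2)L⁴`
    have hSlow : c' * X ^ 2 ≤ Sx := by
      have hSm : star (P *ᵥ v) ⬝ᵥ (P *ᵥ v) = star v ⬝ᵥ (Pᴴ * P) *ᵥ v :=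
        Literature.MathematicalPhysics.QuantumLattice.star_mulVec_dotProduct_mulVec P P v
      have hSp : star (Pᴴ *ᵥ v) ⬝ᵥ (Pᴴ *ᵥ v) = star v ⬝ᵥ (P * Pᴴ) *ᵥ v := by
        rw [Literature.MathematicalPhysics.QuantumLattice.star_mulVec_dotProduct_mulVec,
          conjTranspose_conjTranspose]
      have hb := hCP L v
      rw [← hX, ← hPdef, hv1, Complex.one_re, mul_one, sub_mulVec, dotProduct_sub, Complex.sub_re,
        ← hSm, ← hSp] at hb
      have h1 := (abs_le.1 hb).2
      have h2 : CP ≤ c / 2 * X := by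
        have h : 2 * CP / c ≤ X := by linarith
        rw [div_le_iff₀ hc] at h
        linarith
      have h3 : CP * X ≤ c / 2 * X * X := mul_le_mul_of_nonneg_right h2 hX0.le
      rw [hc', sq]
      linarith
    have hSpos : 0 < Sx := lt_of_lt_of_le (by positivity) hSlow
    obtain ⟨r, hr1, hrS⟩ := exists_smul_unit_of_pos hSpos
    have hvexc' : (star v ⬝ᵥ H *ᵥ v).re ≤ e₂ + ε * X := hvexc
    -- the two excesses
    have hev : (star v ⬝ᵥ A *ᵥ v).re - e₀ ≤ ε * X := by
      have h := re_rayleigh_hubbardTorusWith L U μ ((mem_szSector_iff (N - 2) 0 v).1 hvmem').1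
      rw [hv1, Complex.one_re, mul_one] at h
      have h' : (star v ⬝ᵥ A *ᵥ v).re = (star v ⬝ᵥ H *ᵥ v).re - μ * ((N - 2 : ℕ) : ℝ) := h
      rw [h', he₀₂]
      linarith
    have hew : ((star (r • Pᴴ *ᵥ v) ⬝ᵥ A *ᵥ (r • Pᴴ *ᵥ v)).re - e₀) * Sx ≤
        Φ * X ^ 5 / (2 * (σ * X ^ 2)) + σ * X ^ 2 / 2 * (ε * X) + 6 * K * X ^ 2 + C₃ * Sx := by
      have hray : (star (Pᴴ *ᵥ v) ⬝ᵥ A *ᵥ (Pᴴ *ᵥ v)).re =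
          (star (Pᴴ *ᵥ v) ⬝ᵥ H *ᵥ (Pᴴ *ᵥ v)).re - μ * (N : ℝ) * Sx :=
        re_rayleigh_hubbardTorusWith L U μ ((mem_szSector_iff _ 0 _).1 hPv).1
      have hpart := partner_excess_le (e₂ := e₁) hHherm (szSector (N - 2) 0) hK₂ hvmem' hx hv1
        hvexc' (by positivity : 0 < σ * X ^ 2)
      have hid : ((star (r • Pᴴ *ᵥ v) ⬝ᵥ A *ᵥ (r • Pᴴ *ᵥ v)).re - e₀) * Sx =
          (star (Pᴴ *ᵥ v) ⬝ᵥ H *ᵥ (Pᴴ *ᵥ v)).re - e₁ * Sx := by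
        rw [mulVec_smul, re_star_smul_dotProduct_smul, hray, he₀]
        linear_combination ((star (Pᴴ *ᵥ v) ⬝ᵥ H *ᵥ (Pᴴ *ᵥ v)).re - μ * (N : ℝ) * Sx) * hrS
      rw [hid]
      exact hpart.trans (hbd Pᴴ (e₂ - e₁) Sx (by rw [Matrix.l2_opNorm_conjTranspose]; exact hPn)
        hKPh (abs_le.1 hcost).2 hSpos.le)
    -- the coupling `|⟨v, D Δᴴv⟩|² = ‖Δᴴv‖²/L²`
    have hcoup : ‖star v ⬝ᵥ D *ᵥ (r • Pᴴ *ᵥ v)‖ ^ 2 = Sx / X := by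
      have hz : star v ⬝ᵥ P *ᵥ (Pᴴ *ᵥ v) = ((Sx : ℝ) : ℂ) := by
        have h := star_mulVec_dotProduct Pᴴ v (Pᴴ *ᵥ v)
        rw [conjTranspose_conjTranspose] at h
        rw [← h, hSx, ← eucNorm_sq]
        exact star_dotProduct_self_eq_eucNorm_sq _
      have hD : D = ((L : ℂ))⁻¹ • P := rfl
      rw [hD, smul_mulVec, mulVec_smul, dotProduct_smul, dotProduct_smul, smul_eq_mul, smul_eq_mul,
        hz, norm_mul, norm_mul, norm_inv, Complex.norm_natCast, Complex.norm_real,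
        Real.norm_eq_abs, abs_of_pos hSpos, hX]
      calc ((L : ℝ)⁻¹ * (‖r‖ * Sx)) ^ 2 = ‖r‖ ^ 2 * Sx * Sx / (L : ℝ) ^ 2 := by ring
        _ = Sx / (L : ℝ) ^ 2 := by rw [hrS, one_mul]
    have key := trialPair_gain_le_minEnergyOn_sub A D hAherm P₁ P₂ h12 good hgood hgood₁ hgood₂ S
      hS e₀ hA₁ hA₂ (r • Pᴴ *ᵥ v) v (toP₁ _ (Submodule.smul_mem _ r hPv)) (toP₂ v hvmem') hr1
      hv1 hJ0.le
    rw [hcoup, sub_right_comm] at key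
    exact gain_endgame hJ0 hX0 hc'0 (by positivity) hσ0 key hSlow hev hew hεa hσ1.le hεb hTX

end Torus

end Summit.HubbardSuperconductivity.HubbardSuperconductivity.Theorems.JosephsonMirror
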